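import Summits.CriticalPhenomena.CardyFormulaZ2.Theorems.CardyIKTransportIKMixedBoxCrossingDefectDefs
import Summits.CriticalPhenomena.CardyFormulaZ2.Theorems.CardyIKTransportIKMixedBoxCrossingDefectStubGadget

-- the stub lives in the skeleton's namespace `…Cruxes.IKMixedBoxCrossing.DefectClosureExploration`, not the file path's
set_option linter.dupNamespace false

/-!
# Stub `stub_closureMarkov` of the line `defect-closure-exploration` (crux `IKMixedBoxCrossing`,
stmt-CriticalPhenomena-5911): the closure-exploration strong Markov property `ClosureMarkov`
from the gadget representation `GadgetRepresentation`

Fix `t ≤ 1`, `ρ = maskDensity t`, `V ⊆ innerVertices Λ`, a boundary condition `ξ`, a closed stopping rule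
`explore`, revealed data `A`, an explored set `F` and an event `B` determined by the cells of `G = Λ ∖ F`.
We prove the parametric identity (`maskMix_factor`, `V_G = facesInside V G`, a constant `S` NOT depending on `B`)
`maskMix ρ V Λ ξ (D ↦ {explore D · = F} ∩ A D ∩ B) = S · μ_t^{V_G, G, white}(B)`;
taking `B = univ` identifies `S` with the mask mixture of `{explore = F} ∩ A`, which is `ClosureMarkov`.

Proof of the identity (free-boundary strong Markov property by re-indexing finite sums).
* If `F ⊄ Λ` every event `{explore D · = F}` (`D ⊆ V`) is empty by closedness, so `S = 0` works.
* `V = V_F ⊔ V_G`, `V_F = facesMeeting V F` (`facesMeeting_union_facesInside`): a face of `V ⊆ innerVertices Λ` has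
  its four cells in `Λ`, so it meets `F` or lies inside `G`, not both.
* Counting form (`maskMix_eq_sum_sum`, from `cornerGibbsMeasure_apply` and the RANK LEMMA
  `cornerPartitionFunction_zero_eq_two_pow` of the gadget file):
  `maskMix ρ V Λ ξ E = ∑_{D ⊆ V} ∑_{s ⊆ Λ} ρ^|D| (1-ρ)^{|V|-|D|} · 2^|D| 2^{-|Λ|} · 1[boxFill Λ ξ s ∈ E D, even on D]`.
* Re-index `D = D₁ ⊔ D₂` (`D₁ ⊆ V_F`, `D₂ ⊆ V_G`) and `s = s₁ ⊔ s₂` (`s₁ ⊆ F`, `s₂ ⊆ G`) (`sum_sum_powerset_split`).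
* THE EVENT FACTORISES (`event_iff`): for such a quadruple,
  `explore D σ = F ∧ A D σ ∧ σ ∈ B ∧ σ even on D` (`σ = boxFill Λ ξ (s₁ ∪ s₂)`) iff
  `[explore D₁ σ₁ = F ∧ A D₁ σ₁ ∧ σ₁ even on D₁]` (`σ₁ = boxFill Λ ξ s₁`) and `[τ ∈ B ∧ τ even on D₂]`
  (`τ = boxFill G white s₂`): `σ`/`σ₁` agree on `F`, `σ`/`τ` agree on `G`, `D ∩ facesMeeting V F = D₁ ∩ facesMeeting V F`
  (faces of `D₂` lie inside `G`), so the stopping rule and inside-determinacy transport `explore = F` and `A` both ways;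
  closedness puts every face of `D₁` (which meets `F`) INSIDE `F`, so its parity is read from `σ|_F = σ₁|_F`; faces of
  `D₂` are read from `σ|_G = τ|_G`; `B` is determined on `G`.
* The weights factor accordingly (`coeff_split`), and the `(D₂, s₂)`-sum is, by the same counting form and
  `GadgetRepresentation` applied to the volume `G` with interaction set `V_G ⊆ innerVertices G` and white boundary
  condition (`cornerGibbsMeasure_eq_maskMix`), exactly `μ_t^{V_G, G, white}(B)`.
-/

noncomputable section

namespace Summit.CriticalPhenomena.CardyFormulaZ2.Cruxes.IKMixedBoxCrossing.DefectClosureExploration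

open scoped BigOperators ENNReal NNReal
open MeasureTheory
open Literature.Probability.LatticeModels

/-! ## Sums over the subsets of a disjoint union -/

-- adapted from Literature/Probability/LatticeModels/CurrentsAvoidMixing.lean (`sum_powerset_union_of_disjoint`)
/-- The subsets of a disjoint union `T ∪ T' = U` are the unions `S₀ ∪ S₁`, `S₀ ⊆ T`, `S₁ ⊆ T'`, bijectively. -/
private theorem sum_powerset_eq_sum_sum {α M : Type*} [DecidableEq α] [AddCommMonoid M] {T T' U : Finset α}
    (h : Disjoint T T') (hU : T ∪ T' = U) (f : Finset α → M) :
    ∑ S ∈ U.powerset, f S = ∑ S₀ ∈ T.powerset, ∑ S₁ ∈ T'.powerset, f (S₀ ∪ S₁) := by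
  subst hU
  rw [← Finset.sum_product' T.powerset T'.powerset (fun S₀ S₁ => f (S₀ ∪ S₁))]
  refine (Finset.sum_nbij' (fun p => p.1 ∪ p.2) (fun S => (S ∩ T, S ∩ T')) ?_ ?_ ?_ ?_ ?_).symm
  · intro p hp
    rw [Finset.mem_product, Finset.mem_powerset, Finset.mem_powerset] at hp
    exact Finset.mem_powerset.2 (Finset.union_subset_union hp.1 hp.2)
  · intro S _
    rw [Finset.mem_product, Finset.mem_powerset, Finset.mem_powerset]
    exact ⟨Finset.inter_subset_right, Finset.inter_subset_right⟩
  · intro p hp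
    rw [Finset.mem_product, Finset.mem_powerset, Finset.mem_powerset] at hp
    have h1 : (p.1 ∪ p.2) ∩ T = p.1 := by
      rw [Finset.union_inter_distrib_right, Finset.inter_eq_left.2 hp.1,
        Finset.disjoint_iff_inter_eq_empty.1 (h.symm.mono_left hp.2), Finset.union_empty]
    have h2 : (p.1 ∪ p.2) ∩ T' = p.2 := by
      rw [Finset.union_inter_distrib_right, Finset.inter_eq_left.2 hp.2,
        Finset.disjoint_iff_inter_eq_empty.1 (h.mono_left hp.1), Finset.empty_union]
    rw [h1, h2]
  · intro S hS
    rw [Finset.mem_powerset] at hS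
    change S ∩ T ∪ S ∩ T' = S
    rw [← Finset.inter_union_distrib_left, Finset.inter_eq_left.2 hS]
  · exact fun _ _ => rfl

/-- Double sums over the subsets of `V = V₁ ⊔ V₂` and of `Λ = F ⊔ G`, re-indexed by the four pieces
(masks meeting / inside, black cells explored / unexplored). -/
private theorem sum_sum_powerset_split {α M : Type*} [DecidableEq α] [AddCommMonoid M]
    {V₁ V₂ V F G Λ : Finset α} (hV : Disjoint V₁ V₂) (hVU : V₁ ∪ V₂ = V) (hΛ : Disjoint F G)
    (hΛU : F ∪ G = Λ) (Φ : Finset α → Finset α → M) :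
    ∑ D ∈ V.powerset, ∑ s ∈ Λ.powerset, Φ D s =
      ∑ D₁ ∈ V₁.powerset, ∑ s₁ ∈ F.powerset, ∑ D₂ ∈ V₂.powerset, ∑ s₂ ∈ G.powerset,
        Φ (D₁ ∪ D₂) (s₁ ∪ s₂) := by
  rw [sum_powerset_eq_sum_sum hV hVU]
  refine Finset.sum_congr rfl fun D₁ _ => ?_
  rw [show (∑ D₂ ∈ V₂.powerset, ∑ s ∈ Λ.powerset, Φ (D₁ ∪ D₂) s) =
      ∑ D₂ ∈ V₂.powerset, ∑ s₁ ∈ F.powerset, ∑ s₂ ∈ G.powerset, Φ (D₁ ∪ D₂) (s₁ ∪ s₂) from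
    Finset.sum_congr rfl fun D₂ _ => sum_powerset_eq_sum_sum hΛ hΛU _]
  exact Finset.sum_comm

/-! ## Faces meeting the explored set versus faces inside its complement -/

/-- Membership in `facesMeeting V F`: a face of `V` one of whose four cells lies in `F`. -/
theorem mem_facesMeeting {V F : Finset (Site 2)} {v : Site 2} :
    v ∈ facesMeeting V F ↔ v ∈ V ∧ (cellFace v ∩ F).Nonempty := by
  unfold facesMeeting; exact Finset.mem_filter

/-- Membership in `facesInside V G`: a face of `V` all of whose four cells lie in `G`. -/
theorem mem_facesInside {V G : Finset (Site 2)} {v : Site 2} :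
    v ∈ facesInside V G ↔ v ∈ V ∧ cellFace v ⊆ G := by
  unfold facesInside; exact Finset.mem_filter

/-- A face of `V ⊆ innerVertices Λ` either meets `F` or lies inside `Λ ∖ F`:
`facesMeeting V F ∪ facesInside V (Λ ∖ F) = V`. -/
theorem facesMeeting_union_facesInside {V Λ : Finset (Site 2)} (hV : V ⊆ innerVertices Λ)
    (F : Finset (Site 2)) : facesMeeting V F ∪ facesInside V (Λ \ F) = V := by
  ext v
  rw [Finset.mem_union, mem_facesMeeting, mem_facesInside]
  constructor
  · rintro (h | h) <;> exact h.1
  · intro hv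
    by_cases h : (cellFace v ∩ F).Nonempty
    · exact Or.inl ⟨hv, h⟩
    · exact Or.inr ⟨hv, fun c hc => Finset.mem_sdiff.2
        ⟨mem_innerVertices_iff.1 (hV hv) hc, fun hcF => h ⟨c, Finset.mem_inter.2 ⟨hc, hcF⟩⟩⟩⟩

/-- … and not both: `facesMeeting V F` and `facesInside V (Λ ∖ F)` are disjoint. -/
theorem disjoint_facesMeeting_facesInside (V Λ F : Finset (Site 2)) :
    Disjoint (facesMeeting V F) (facesInside V (Λ \ F)) := by
  rw [Finset.disjoint_left]
  intro v h1 h2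
  obtain ⟨c, hc⟩ := (mem_facesMeeting.1 h1).2
  rw [Finset.mem_inter] at hc
  exact (Finset.mem_sdiff.1 ((mem_facesInside.1 h2).2 hc.1)).2 hc.2

/-- Faces of `V` inside `G` are inner vertices of `G` (so the rank lemma and the gadget representation apply
to the volume `G` with interaction set `facesInside V G`). -/
theorem facesInside_subset_innerVertices (V G : Finset (Site 2)) : facesInside V G ⊆ innerVertices G :=
  fun _ hv => mem_innerVertices_iff.2 (mem_facesInside.1 hv).2

/-- A mask `D₁ ∪ D₂` with `D₂` inside `Λ ∖ F` meets `F` only through `D₁`. -/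
private theorem union_inter_facesMeeting {V Λ F D₁ D₂ : Finset (Site 2)}
    (hD₂ : D₂ ⊆ facesInside V (Λ \ F)) :
    (D₁ ∪ D₂) ∩ facesMeeting V F = D₁ ∩ facesMeeting V F := by
  ext v
  simp only [Finset.mem_inter, Finset.mem_union]
  constructor
  · rintro ⟨h | h, hv⟩
    · exact ⟨h, hv⟩
    · exact absurd hv (Finset.disjoint_right.1 (disjoint_facesMeeting_facesInside V Λ F) (hD₂ h))
  · exact fun ⟨h, hv⟩ => ⟨Or.inl h, hv⟩

/-! ## Fillings with a split black set -/

/-- Adding black cells inside `G` does not change the filling off `G`. -/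
private theorem boxFill_union_apply_of_not_mem {Λ G : Finset (Site 2)} (ξ : Site 2 → Bool)
    (s₁ : Finset (Site 2)) {s₂ : Finset (Site 2)} (hs₂ : s₂ ⊆ G) {c : Site 2} (hc : c ∉ G) :
    boxFill Λ ξ (s₁ ∪ s₂) c = boxFill Λ ξ s₁ c := by
  by_cases hcΛ : c ∈ Λ
  · rw [boxFill_apply_of_mem ξ _ hcΛ, boxFill_apply_of_mem ξ _ hcΛ]
    have : c ∉ s₂ := fun h => hc (hs₂ h)
    simp [Finset.mem_union, this]
  · rw [boxFill_apply_of_not_mem ξ _ hcΛ, boxFill_apply_of_not_mem ξ _ hcΛ]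

/-- On `Λ ∖ F`, the filling of `Λ` with black set `s₁ ∪ s₂`, `s₁ ⊆ F`, is the white-boundary filling of
`Λ ∖ F` with black set `s₂`. -/
private theorem boxFill_union_apply_of_mem_sdiff {Λ F : Finset (Site 2)} (ξ : Site 2 → Bool)
    {s₁ : Finset (Site 2)} (hs₁ : s₁ ⊆ F) (s₂ : Finset (Site 2)) {c : Site 2} (hc : c ∈ Λ \ F) :
    boxFill Λ ξ (s₁ ∪ s₂) c = boxFill (Λ \ F) (fun _ => false) s₂ c := by
  obtain ⟨hcΛ, hcF⟩ := Finset.mem_sdiff.1 hc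
  rw [boxFill_apply_of_mem ξ _ hcΛ, boxFill_apply_of_mem _ _ hc]
  have : c ∉ s₁ := fun h => hcF (hs₁ h)
  simp [Finset.mem_union, this]

/-! ## The event factorises -/

/-- THE EVENT FACTORISES. For `D₁ ⊆ facesMeeting V F`, `D₂ ⊆ facesInside V (Λ ∖ F)`, `s₁ ⊆ F`,
`s₂ ⊆ Λ ∖ F`, with `σ = boxFill Λ ξ (s₁ ∪ s₂)`, `σ₁ = boxFill Λ ξ s₁`, `τ = boxFill (Λ ∖ F) white s₂`:
`[explore (D₁ ∪ D₂) σ = F ∧ A ∧ σ ∈ B ∧ σ even on D₁ ∪ D₂] ↔ [explore D₁ σ₁ = F ∧ A ∧ σ₁ even on D₁] ∧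
[τ ∈ B ∧ τ even on D₂]` — stopping rule + inside-determinacy (the configurations agree on `F` and have the
same masked faces meeting `F`), closedness (masked faces meeting `F` lie inside `F`), `B` determined on `Λ ∖ F`. -/
private theorem event_iff {V Λ F : Finset (Site 2)} {ξ : Site 2 → Bool}
    {explore : Finset (Site 2) → (Site 2 → Bool) → Finset (Site 2)}
    (hStop : IsStoppingRule V explore) (hClosed : IsClosedRule V Λ explore)
    {A : Finset (Site 2) → (Site 2 → Bool) → Prop} (hA : InsideDetermined V explore A)
    {B : Set (Site 2 → Bool)} (hB : DeterminedOn (Λ \ F) B)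
    {D₁ D₂ s₁ s₂ : Finset (Site 2)} (hD₁ : D₁ ⊆ facesMeeting V F) (hD₂ : D₂ ⊆ facesInside V (Λ \ F))
    (hs₁ : s₁ ⊆ F) (hs₂ : s₂ ⊆ Λ \ F) :
    boxFill Λ ξ (s₁ ∪ s₂) ∈ {σ | σ ∈ {σ | explore (D₁ ∪ D₂) σ = F ∧ A (D₁ ∪ D₂) σ ∧ σ ∈ B} ∧
        ∀ f ∈ D₁ ∪ D₂, ¬ IsOddFace σ f} ↔
      boxFill Λ ξ s₁ ∈ {σ | (explore D₁ σ = F ∧ A D₁ σ) ∧ ∀ f ∈ D₁, ¬ IsOddFace σ f} ∧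
        boxFill (Λ \ F) (fun _ => false) s₂ ∈ {σ | σ ∈ B ∧ ∀ f ∈ D₂, ¬ IsOddFace σ f} := by
  set σ := boxFill Λ ξ (s₁ ∪ s₂)
  set σ₁ := boxFill Λ ξ s₁
  set τ := boxFill (Λ \ F) (fun _ => false) s₂
  have hD₁V : D₁ ⊆ V := fun v hv => (mem_facesMeeting.1 (hD₁ hv)).1
  have hDV : D₁ ∪ D₂ ⊆ V := Finset.union_subset hD₁V fun v hv => (mem_facesInside.1 (hD₂ hv)).1
  have hagF : ∀ c ∈ F, σ c = σ₁ c := fun c hc =>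
    boxFill_union_apply_of_not_mem ξ s₁ hs₂ fun h => (Finset.mem_sdiff.1 h).2 hc
  have hagG : ∀ c ∈ Λ \ F, σ c = τ c := fun c hc => boxFill_union_apply_of_mem_sdiff ξ hs₁ s₂ hc
  have hint : (D₁ ∪ D₂) ∩ facesMeeting V F = D₁ ∩ facesMeeting V F := union_inter_facesMeeting hD₂
  have hparG : ∀ f ∈ D₂, (IsOddFace σ f ↔ IsOddFace τ f) := fun f hf =>
    isOddFace_congr fun x hx => hagG x ((mem_facesInside.1 (hD₂ hf)).2 hx)
  have hparF : (∀ f ∈ D₁, cellFace f ⊆ F) → ∀ f ∈ D₁, (IsOddFace σ f ↔ IsOddFace σ₁ f) :=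
    fun hFf f hf => isOddFace_congr fun x hx => hagF x (hFf f hf hx)
  simp only [Set.mem_setOf_eq]
  constructor
  · rintro ⟨⟨hE, hAD, hBm⟩, hev⟩
    have hFf : ∀ f ∈ D₁, cellFace f ⊆ F := by
      intro f hf
      have h := (hClosed (D₁ ∪ D₂) σ hDV).2 f (Finset.mem_union_left _ hf)
      rw [hE] at h
      exact h (mem_facesMeeting.1 (hD₁ hf)).2
    have hagE : ∀ c ∈ explore (D₁ ∪ D₂) σ, σ₁ c = σ c := fun c hc => (hagF c (hE ▸ hc)).symm
    have hintE : D₁ ∩ facesMeeting V (explore (D₁ ∪ D₂) σ) =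
        (D₁ ∪ D₂) ∩ facesMeeting V (explore (D₁ ∪ D₂) σ) := by
      rw [hE, hint]
    exact ⟨⟨⟨(hStop _ _ _ _ hDV hD₁V hagE hintE).trans hE, hA _ _ _ _ hDV hD₁V hAD hagE hintE⟩,
      fun f hf hodd => hev f (Finset.mem_union_left _ hf) ((hparF hFf f hf).2 hodd)⟩,
      (hB σ τ hagG).1 hBm, fun f hf hodd => hev f (Finset.mem_union_right _ hf) ((hparG f hf).2 hodd)⟩
  · rintro ⟨⟨⟨hE, hAD⟩, hev₁⟩, hBm, hev₂⟩
    have hFf : ∀ f ∈ D₁, cellFace f ⊆ F := by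
      intro f hf
      have h := (hClosed D₁ σ₁ hD₁V).2 f hf
      rw [hE] at h
      exact h (mem_facesMeeting.1 (hD₁ hf)).2
    have hagE : ∀ c ∈ explore D₁ σ₁, σ c = σ₁ c := fun c hc => hagF c (hE ▸ hc)
    have hintE : (D₁ ∪ D₂) ∩ facesMeeting V (explore D₁ σ₁) = D₁ ∩ facesMeeting V (explore D₁ σ₁) := by
      rw [hE, hint]
    refine ⟨⟨(hStop _ _ _ _ hD₁V hDV hagE hintE).trans hE, hA _ _ _ _ hD₁V hDV hAD hagE hintE,
      (hB σ τ hagG).2 hBm⟩, fun f hf => ?_⟩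
    rcases Finset.mem_union.1 hf with hf | hf
    · exact fun hodd => hev₁ f hf ((hparF hFf f hf).1 hodd)
    · exact fun hodd => hev₂ f hf ((hparG f hf).1 hodd)

/-! ## Counting forms of the measures -/

/-- `(2 ^ (n - k))⁻¹ = 2 ^ k · (2 ^ n)⁻¹` in `ℝ≥0∞` for `k ≤ n`. -/
private theorem inv_two_pow_sub {n k : ℕ} (h : k ≤ n) :
    ((2 : ℝ≥0∞) ^ (n - k))⁻¹ = 2 ^ k * ((2 : ℝ≥0∞) ^ n)⁻¹ := by
  have h2 : (2 : ℝ≥0∞) ^ k ≠ 0 := pow_ne_zero _ two_ne_zero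
  have h2' : (2 : ℝ≥0∞) ^ k ≠ ∞ := ENNReal.pow_ne_top ENNReal.ofNat_ne_top
  obtain ⟨m, rfl⟩ := Nat.exists_eq_add_of_le h
  rw [Nat.add_sub_cancel_left, pow_add, ENNReal.mul_inv (Or.inl h2) (Or.inl h2'), ← mul_assoc,
    ENNReal.mul_inv_cancel h2 h2', one_mul]

/-- COUNTING FORM of the `t = 0` measure with `D ⊆ innerVertices Λ` (rank lemma `Z_0^D = 2^{|Λ|-|D|}`):
`μ_0^D(E) = 2^|D| · 2^{-|Λ|} · #{s ⊆ Λ : boxFill Λ ξ s ∈ E with no odd face in D}`. -/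
theorem cornerGibbsMeasure_zero_eq_sum {D Λ : Finset (Site 2)} (hD : D ⊆ innerVertices Λ)
    (ξ : Site 2 → Bool) (E : Set (Site 2 → Bool)) :
    cornerGibbsMeasure 0 D Λ ξ E = 2 ^ D.card * ((2 : ℝ≥0∞) ^ Λ.card)⁻¹ *
      ∑ s ∈ Λ.powerset, {σ | σ ∈ E ∧ ∀ f ∈ D, ¬ IsOddFace σ f}.indicator 1 (boxFill Λ ξ s) := by
  rw [cornerGibbsMeasure_apply, cornerPartitionFunction_zero_eq_two_pow hD ξ,
    inv_two_pow_sub (Finset.card_le_card (hD.trans (innerVertices_subset Λ)))]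
  congr 1
  refine Finset.sum_congr rfl fun s _ => ?_
  by_cases hE : boxFill Λ ξ s ∈ E
  · rw [Set.indicator_of_mem hE, cornerWeight_zero_eq_ite]
    by_cases hev : ∀ f ∈ D, ¬ IsOddFace (boxFill Λ ξ s) f
    · have hmem : boxFill Λ ξ s ∈ {σ | σ ∈ E ∧ ∀ f ∈ D, ¬ IsOddFace σ f} := ⟨hE, hev⟩
      rw [if_pos hev, Set.indicator_of_mem hmem, Pi.one_apply]
    · have hnm : boxFill Λ ξ s ∉ {σ | σ ∈ E ∧ ∀ f ∈ D, ¬ IsOddFace σ f} := fun h => hev h.2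
      rw [if_neg hev, Set.indicator_of_notMem hnm]
  · have hnm : boxFill Λ ξ s ∉ {σ | σ ∈ E ∧ ∀ f ∈ D, ¬ IsOddFace σ f} := fun h => hE h.1
    rw [Set.indicator_of_notMem hE, Set.indicator_of_notMem hnm]

/-- COUNTING FORM of the mask mixture for `V ⊆ innerVertices Λ`:
`maskMix ρ V Λ ξ E = ∑_{D ⊆ V} ∑_{s ⊆ Λ} ρ^|D| (1-ρ)^{|V|-|D|} · 2^|D| 2^{-|Λ|} · 1[boxFill Λ ξ s ∈ E D, even on D]`. -/
theorem maskMix_eq_sum_sum {ρ : ℝ} {V Λ : Finset (Site 2)} (hV : V ⊆ innerVertices Λ) (ξ : Site 2 → Bool)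
    (E : Finset (Site 2) → Set (Site 2 → Bool)) :
    maskMix ρ V Λ ξ E = ∑ D ∈ V.powerset, ∑ s ∈ Λ.powerset,
      ENNReal.ofReal (ρ ^ D.card * (1 - ρ) ^ (V.card - D.card)) * (2 ^ D.card * ((2 : ℝ≥0∞) ^ Λ.card)⁻¹) *
        {σ | σ ∈ E D ∧ ∀ f ∈ D, ¬ IsOddFace σ f}.indicator 1 (boxFill Λ ξ s) := by
  unfold maskMix
  refine Finset.sum_congr rfl fun D hD => ?_
  rw [cornerGibbsMeasure_zero_eq_sum ((Finset.mem_powerset.1 hD).trans hV) ξ (E D), Finset.mul_sum,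
    Finset.mul_sum]
  refine Finset.sum_congr rfl fun s _ => ?_
  simp only [mul_assoc]

/-- By the gadget representation (`t ≤ 1`, `W ⊆ innerVertices G`), the corner Gibbs measure of an event is
the mask mixture of the constant family of that event. -/
theorem cornerGibbsMeasure_eq_maskMix (hGad : GadgetRepresentation) {t : ℝ≥0} (ht : t ≤ 1)
    {W G : Finset (Site 2)} (hW : W ⊆ innerVertices G) (ξ : Site 2 → Bool) (B : Set (Site 2 → Bool)) :
    cornerGibbsMeasure t W G ξ B = maskMix (maskDensity t) W G ξ (fun _ => B) := by
  rw [hGad t ht W G hW ξ, Measure.finsetSum_apply]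
  unfold maskMix
  refine Finset.sum_congr rfl fun D _ => ?_
  rw [Measure.smul_apply, smul_eq_mul]

/-- THE WEIGHTS FACTOR: with `0 ≤ ρ ≤ 1`, `d₁ ≤ v₁`, `d₂ ≤ v₂`,
`ρ^{d₁+d₂} (1-ρ)^{v₁+v₂-d₁-d₂} · 2^{d₁+d₂} 2^{-(n₁+n₂)} =
[ρ^{d₁} (1-ρ)^{v₁-d₁} 2^{d₁} 2^{-n₁}] · [ρ^{d₂} (1-ρ)^{v₂-d₂} 2^{d₂} 2^{-n₂}]`. -/
private theorem coeff_split {ρ : ℝ} (hρ : 0 ≤ ρ) (hρ' : 0 ≤ 1 - ρ) {d₁ d₂ v₁ v₂ n₁ n₂ : ℕ}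
    (hd₁ : d₁ ≤ v₁) (hd₂ : d₂ ≤ v₂) :
    ENNReal.ofReal (ρ ^ (d₁ + d₂) * (1 - ρ) ^ (v₁ + v₂ - (d₁ + d₂))) *
        (2 ^ (d₁ + d₂) * ((2 : ℝ≥0∞) ^ (n₁ + n₂))⁻¹) =
      ENNReal.ofReal (ρ ^ d₁ * (1 - ρ) ^ (v₁ - d₁)) * 2 ^ d₁ * ((2 : ℝ≥0∞) ^ n₁)⁻¹ *
        (ENNReal.ofReal (ρ ^ d₂ * (1 - ρ) ^ (v₂ - d₂)) * (2 ^ d₂ * ((2 : ℝ≥0∞) ^ n₂)⁻¹)) := by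
  have e : v₁ + v₂ - (d₁ + d₂) = (v₁ - d₁) + (v₂ - d₂) := by omega
  have hw : ρ ^ (d₁ + d₂) * (1 - ρ) ^ ((v₁ - d₁) + (v₂ - d₂)) =
      (ρ ^ d₁ * (1 - ρ) ^ (v₁ - d₁)) * (ρ ^ d₂ * (1 - ρ) ^ (v₂ - d₂)) := by
    rw [pow_add, pow_add]; ring
  rw [e, hw, ENNReal.ofReal_mul (mul_nonneg (pow_nonneg hρ _) (pow_nonneg hρ' _)), pow_add, pow_add,
    ENNReal.mul_inv (Or.inl (pow_ne_zero _ two_ne_zero)) (Or.inl (ENNReal.pow_ne_top ENNReal.ofNat_ne_top))]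
  ring

/-! ## The inner sum over the unexplored data and the assembly -/

/-- THE INNER SUM. For fixed explored data `(D₁ ⊆ facesMeeting V F, s₁ ⊆ F)` the sum over the unexplored
data `(D₂ ⊆ facesInside V (Λ ∖ F), s₂ ⊆ Λ ∖ F)` of the joint weight of `{explore = F} ∩ A ∩ B ∩ {even}`
is `K(D₁, s₁) · maskMix ρ (facesInside V (Λ ∖ F)) (Λ ∖ F) white (· ↦ B)` with `K` independent of `B`. -/
private theorem inner_factor {t : ℝ≥0} (ht : t ≤ 1) {V Λ F : Finset (Site 2)} (hV : V ⊆ innerVertices Λ)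
    (hF : F ⊆ Λ) {ξ : Site 2 → Bool} {explore : Finset (Site 2) → (Site 2 → Bool) → Finset (Site 2)}
    (hStop : IsStoppingRule V explore) (hClosed : IsClosedRule V Λ explore)
    {A : Finset (Site 2) → (Site 2 → Bool) → Prop} (hA : InsideDetermined V explore A)
    {B : Set (Site 2 → Bool)} (hB : DeterminedOn (Λ \ F) B)
    {D₁ s₁ : Finset (Site 2)} (hD₁ : D₁ ⊆ facesMeeting V F) (hs₁ : s₁ ⊆ F) :
    ∑ D₂ ∈ (facesInside V (Λ \ F)).powerset, ∑ s₂ ∈ (Λ \ F).powerset,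
      ENNReal.ofReal (maskDensity t ^ (D₁ ∪ D₂).card * (1 - maskDensity t) ^ (V.card - (D₁ ∪ D₂).card)) *
        (2 ^ (D₁ ∪ D₂).card * ((2 : ℝ≥0∞) ^ Λ.card)⁻¹) *
        {σ | σ ∈ {σ | explore (D₁ ∪ D₂) σ = F ∧ A (D₁ ∪ D₂) σ ∧ σ ∈ B} ∧
          ∀ f ∈ D₁ ∪ D₂, ¬ IsOddFace σ f}.indicator 1 (boxFill Λ ξ (s₁ ∪ s₂)) =
    ENNReal.ofReal (maskDensity t ^ D₁.card * (1 - maskDensity t) ^ ((facesMeeting V F).card - D₁.card)) *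
        2 ^ D₁.card * ((2 : ℝ≥0∞) ^ F.card)⁻¹ *
        {σ | (explore D₁ σ = F ∧ A D₁ σ) ∧ ∀ f ∈ D₁, ¬ IsOddFace σ f}.indicator 1 (boxFill Λ ξ s₁) *
      maskMix (maskDensity t) (facesInside V (Λ \ F)) (Λ \ F) (fun _ => false) (fun _ => B) := by
  have hVG : facesInside V (Λ \ F) ⊆ innerVertices (Λ \ F) := facesInside_subset_innerVertices _ _
  have hVcard : V.card = (facesMeeting V F).card + (facesInside V (Λ \ F)).card := by
    rw [← Finset.card_union_of_disjoint (disjoint_facesMeeting_facesInside V Λ F),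
      facesMeeting_union_facesInside hV F]
  have hΛcard : Λ.card = F.card + (Λ \ F).card := by
    rw [← Finset.card_sdiff_add_card_eq_card hF, add_comm]
  rw [maskMix_eq_sum_sum hVG (fun _ => false) (fun _ => B), Finset.mul_sum]
  refine Finset.sum_congr rfl fun D₂ hD₂ => ?_
  rw [Finset.mul_sum]
  refine Finset.sum_congr rfl fun s₂ hs₂ => ?_
  rw [Finset.mem_powerset] at hD₂ hs₂
  have hiff := event_iff (ξ := ξ) hStop hClosed hA hB hD₁ hD₂ hs₁ hs₂
  have hdisj : Disjoint D₁ D₂ := (disjoint_facesMeeting_facesInside V Λ F).mono hD₁ hD₂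
  rw [Finset.card_union_of_disjoint hdisj, hVcard, hΛcard]
  by_cases hP : boxFill Λ ξ s₁ ∈ {σ | (explore D₁ σ = F ∧ A D₁ σ) ∧ ∀ f ∈ D₁, ¬ IsOddFace σ f}
  · by_cases hQ : boxFill (Λ \ F) (fun _ => false) s₂ ∈ {σ | σ ∈ B ∧ ∀ f ∈ D₂, ¬ IsOddFace σ f}
    · rw [Set.indicator_of_mem (hiff.2 ⟨hP, hQ⟩), Set.indicator_of_mem hP, Set.indicator_of_mem hQ]
      simp only [Pi.one_apply, mul_one]
      exact coeff_split (maskDensity_nonneg ht) (sub_nonneg.2 (maskDensity_le_one t))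
        (Finset.card_le_card hD₁) (Finset.card_le_card hD₂)
    · rw [Set.indicator_of_notMem (fun h => hQ (hiff.1 h).2), Set.indicator_of_notMem hQ]
      simp only [mul_zero]
  · rw [Set.indicator_of_notMem (fun h => hP (hiff.1 h).1), Set.indicator_of_notMem hP]
    simp only [mul_zero, zero_mul]

/-- **THE STRONG MARKOV IDENTITY, parametric form.** For `t ≤ 1`, `V ⊆ innerVertices Λ`, a closed stopping
rule, inside-determined data `A` and an explored set `F`, there is a constant `S` (the joint weight of
`{explore = F} ∩ A`, or `0` if `F ⊄ Λ`) such that for EVERY event `B` determined on `Λ ∖ F`,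
`maskMix ρ V Λ ξ (D ↦ {explore D · = F} ∩ A D ∩ B) = S · μ_t^{facesInside V (Λ ∖ F), Λ ∖ F, white}(B)`. -/
theorem maskMix_factor (hGad : GadgetRepresentation) {t : ℝ≥0} (ht : t ≤ 1) {V Λ : Finset (Site 2)}
    (hV : V ⊆ innerVertices Λ) (ξ : Site 2 → Bool)
    {explore : Finset (Site 2) → (Site 2 → Bool) → Finset (Site 2)}
    (hStop : IsStoppingRule V explore) (hClosed : IsClosedRule V Λ explore)
    {A : Finset (Site 2) → (Site 2 → Bool) → Prop} (hA : InsideDetermined V explore A) (F : Finset (Site 2)) :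
    ∃ S : ℝ≥0∞, ∀ B : Set (Site 2 → Bool), DeterminedOn (Λ \ F) B →
      maskMix (maskDensity t) V Λ ξ (fun D => {σ | explore D σ = F ∧ A D σ ∧ σ ∈ B}) =
        S * cornerGibbsMeasure t (facesInside V (Λ \ F)) (Λ \ F) (fun _ => false) B := by
  by_cases hF : F ⊆ Λ
  · refine ⟨∑ D₁ ∈ (facesMeeting V F).powerset, ∑ s₁ ∈ F.powerset,
      ENNReal.ofReal (maskDensity t ^ D₁.card * (1 - maskDensity t) ^ ((facesMeeting V F).card - D₁.card)) *
        2 ^ D₁.card * ((2 : ℝ≥0∞) ^ F.card)⁻¹ *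
        {σ | (explore D₁ σ = F ∧ A D₁ σ) ∧ ∀ f ∈ D₁, ¬ IsOddFace σ f}.indicator 1 (boxFill Λ ξ s₁),
      fun B hB => ?_⟩
    rw [maskMix_eq_sum_sum hV ξ, sum_sum_powerset_split (disjoint_facesMeeting_facesInside V Λ F)
      (facesMeeting_union_facesInside hV F) Finset.disjoint_sdiff (Finset.union_sdiff_of_subset hF),
      Finset.sum_mul]
    refine Finset.sum_congr rfl fun D₁ hD₁ => ?_
    rw [Finset.sum_mul]
    refine Finset.sum_congr rfl fun s₁ hs₁ => ?_
    rw [cornerGibbsMeasure_eq_maskMix hGad ht (facesInside_subset_innerVertices V (Λ \ F)) (fun _ => false) B]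
    exact inner_factor ht hV hF hStop hClosed hA hB (Finset.mem_powerset.1 hD₁) (Finset.mem_powerset.1 hs₁)
  · refine ⟨0, fun B _ => ?_⟩
    rw [zero_mul]
    unfold maskMix
    refine Finset.sum_eq_zero fun D hD => ?_
    have hempty : {σ : Site 2 → Bool | explore D σ = F ∧ A D σ ∧ σ ∈ B} = ∅ :=
      Set.eq_empty_of_forall_notMem fun σ h => hF (h.1 ▸ (hClosed D σ (Finset.mem_powerset.1 hD)).1)
    simp only [hempty, measure_empty, mul_zero]

/-- **STUB `stub_closureMarkov`** (registered stub of the line `defect-closure-exploration`): the gadget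
representation implies the closure-exploration strong Markov property — on `{explored set = F} ∩ A`, the
colours of `Λ ∖ F` follow the FREE corner-fugacity field of `Λ ∖ F` with interaction set
`facesInside V (Λ ∖ F)`, whatever was revealed. -/
theorem stub_closureMarkov : GadgetRepresentation → ClosureMarkov := by
  intro hGad t ht V Λ hV ξ explore hStop hClosed A hA F B hB
  obtain ⟨S, hS⟩ := maskMix_factor hGad ht hV ξ hStop hClosed hA F
  have h1 := hS B hB
  have h2 := hS Set.univ (fun _ _ _ => Iff.rfl)
  rw [measure_univ, mul_one] at h2
  have h3 : maskMix (maskDensity t) V Λ ξ (fun D => {σ | explore D σ = F ∧ A D σ}) = S := by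
    rw [← h2]
    congr 1; funext D; ext σ
    simp only [Set.mem_setOf_eq, Set.mem_univ, and_true]
  rw [h1, h3]

end Summit.CriticalPhenomena.CardyFormulaZ2.Cruxes.IKMixedBoxCrossing.DefectClosureExploration

end
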